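import Literature.Topology.FourManifolds.LefschetzHandlebody
import Literature.Topology.FourManifolds.HandleAttachingMapsSymmetry
import Literature.Geometry.Symplectic.TwoHandleIsotopyProofs
import HarnessLib

/-!
# The mirror ambiguity of Kas' meridians (Kas design for NF2 clause 3, lemma (G); wave 4, W4-G)
(sub-goal `stub_Kas_mirror_link` of stub `stub_modelsOn_counts`, line `modp-braid-orbits`, r9,
crux `ConvexBisection.AcyclicBisectionExists`, item stmt-SmoothPoincare4-10508)

The Kas design (`work/stubs/Kas_Design.lean`, W3-1) presents `H₁(∂ Base g ∖ ⋃ Kᵢ; ℤ)` by the base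
page and the MERIDIAN classes `mᵢ := (h̄ᵢ)_*[φ ↦ (θ₀, φ)/√2]` of the attaching circles `Kᵢ`, read
through the attaching maps `h̄ᵢ : T → Base g` themselves, and states (F) `Kas_seamOff_presentation`
(kernel = page relations `Σⱼ stdSymp(γⱼ, a) mⱼ`) and (G) `Kas_longitude_formula`
(`ℓᵢ = P(γᵢ) + εᵢ mᵢ + Σ_{j>i} stdSymp(γⱼ, γᵢ) mⱼ`) for EVERY Lefschetz link `h`.  This file proves
that such statements cannot hold as stated: `IsLefschetzLink g l h` constrains only the attaching
circle `h̄ᵢ|S¹×0`, its handle framing `dh̄ᵢ(∂/∂x_μ,₁)` and the range of `h̄ᵢ`, all three of which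
are UNCHANGED when `h̄ᵢ` is precomposed with the reflection `diag(1, 1, 1, −1)` of the second
normal coordinate of the model handle (a symmetry of the model handle in the sense of
`HandleAttachingMapsSymmetry.lean`, so the multi-attachments `X` do not change either:
`isMultiAttachment_reframe_iff`), whereas that reflection REVERSES the model meridian.  So from any
Lefschetz link one gets `2ⁿ` Lefschetz links with the same handlebodies, the same seam, the same
longitudes and independently reversed meridians (`stub_Kas_mirror_link`); (F) and (G) hold for at
most one sign pattern up to a global sign (they fail e.g. for `l = [(0, ±)]`, where `m₀` has
infinite order, for one of the two mirror images).  The corrected statements orient the meridians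
by `∂ Base g` (right-handed meridians: linking number `+1` with `Kᵢ`, equivalently the boundary of a
normal disc rotating from `iK'` towards the horizontal normal `n` of the page frame); they are
written out, with the full sign computation of (G), in the docstring of the companion file
`…KasLoops.lean` (W4-G).

Contents: §1 the mirror `mirrorIso`, `mirrorMap h b = h.reframe (mirrorIso b)` and its invariants
(`attachingCircle_mirrorMap`, `attachingFraming_mirrorMap` — via the tree's
`attachingFraming_eq_mfderiv_comp_tubeArcPt`: the framing is the velocity of `h̄` along the arc
`(cos s θ, sin s, 0)`, which lies in the mirror hyperplane —, `range_mirrorMap`, `core_mirrorMap`);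
§2 `mirrorFamily h p`, `isLefschetzLink_mirrorFamily`, `isMultiAttachment_mirrorFamily_iff`,
`coe_coresComplement_mirrorFamily`; §3 the registered sub-goal.  Everything is proved; no `sorry`.
-/

noncomputable section

set_option linter.dupNamespace false

open scoped Manifold ContDiff Topology
open Set Function Metric
open Literature.Topology.FourManifolds Literature.Topology.FourManifolds.LefschetzBase
  Literature.Topology.FourManifolds.HandleAttachingMap Literature.Geometry.Symplectic

namespace Summit.SmoothPoincare4.SmoothPoincare4.Theorems.AcyclicBisectionExists.ModpBraidOrbits

/-- Local notation: the model Euclidean space `ℝ⁴`. -/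
local notation "E4" => EuclideanSpace ℝ (Fin 4)
/-- Local notation: the unit circle in `ℝ²`. -/
local notation "𝕊¹" => (Metric.sphere (0 : EuclideanSpace ℝ (Fin 2)) 1)
/-- Local notation: the closed unit ball in `ℝ⁴`. -/
local notation "𝔻⁴" => (Metric.closedBall (0 : EuclideanSpace ℝ (Fin 4)) 1)

/-! ## §1 The mirror `(x_λ, x_μ,₁, x_μ,₂) ↦ (x_λ, x_μ,₁, −x_μ,₂)` of the model handle -/

section Mirror

/-- The signs `(1, 1, 1, −1)` of the mirror reflection of the model `2`-handle `D² × D²`: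
reflect the second normal coordinate `x_μ,₂`. -/
def mirrorSign : Fin 4 → ℝ := ![1, 1, 1, -1]

/-- The mirror signs square to one. [folklore] -/
theorem mirrorSign_mul_self (i : Fin 4) : mirrorSign i * mirrorSign i = 1 := by
  fin_cases i <;> simp [mirrorSign]

/-- The mirror reflection `diag(1, 1, 1, −1)` of `ℝ⁴` switched on (`b = true`) or off
(`b = false`, the identity), as a linear isometry. -/
def mirrorIso (b : Bool) : E4 ≃ₗᵢ[ℝ] E4 :=
  bif b then diagonalIsometry mirrorSign mirrorSign_mul_self else LinearIsometryEquiv.refl ℝ E4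

/-- The mirror is a symmetry of the model `2`-handle (it preserves `|x_λ|²` and commutes with the
block rescalings), so attaching maps can be re-framed by it (`HandleAttachingMap.reframe`).
[folklore] -/
theorem isHandleSymmetry_mirrorIso (b : Bool) : IsHandleSymmetry 2 (mirrorIso b) := by
  cases b
  · exact IsHandleSymmetry.refl 2
  · exact isHandleSymmetry_diagonalIsometry 2 mirrorSign mirrorSign_mul_self

/-- Coordinates of the mirror: only `x₃` changes sign. [folklore] -/
theorem mirrorIso_true_apply (u : E4) (i : Fin 4) : mirrorIso true u i = mirrorSign i * u i :=
  diagonalIsometry_apply mirrorSign mirrorSign_mul_self u i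

/-- The mirror fixes the hyperplane `x₃ = 0` pointwise (which contains the attaching circle
`S¹ × 0`, the framing direction `e₂ = ∂/∂x_μ,₁` and the whole arc `(cos s θ, sin s, 0)`). [folklore] -/
theorem mirrorIso_eq_self (b : Bool) {u : E4} (hu : u 3 = 0) : mirrorIso b u = u := by
  cases b
  · rfl
  · ext i
    rw [mirrorIso_true_apply]
    fin_cases i <;> simp [mirrorSign, hu]

variable {M : Type} [TopologicalSpace M] [ChartedSpace (EuclideanHalfSpace 4) M]

/-- **The mirror of a `2`-handle attaching map** `h̄ ∘ diag(1, 1, 1, −1)` (switched on or off by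
`b`): Kosinski's re-framing of `h̄` by the reflection of the second normal coordinate. -/
def mirrorMap (h : HandleAttachingMap 3 2 M) (b : Bool) : HandleAttachingMap 3 2 M :=
  h.reframe (mirrorIso b) (isHandleSymmetry_mirrorIso b)

/-- The mirror of an attaching map, evaluated. [folklore] -/
theorem mirrorMap_apply (h : HandleAttachingMap 3 2 M) (b : Bool) (y : ↥(handleTube 3 2)) :
    (mirrorMap h b).toFun y = h.toFun (tubeCongr (mirrorIso b) (isHandleSymmetry_mirrorIso b) y) :=
  rfl

/-- The mirror fixes the tube points with `x₃ = 0`. [folklore] -/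
theorem tubeCongr_mirrorIso_eq_self (b : Bool) {y : ↥(handleTube 3 2)}
    (hy : (((y : 𝔻⁴) : E4)) 3 = 0) :
    tubeCongr (mirrorIso b) (isHandleSymmetry_mirrorIso b) y = y := by
  apply Subtype.ext; apply Subtype.ext
  rw [coe_coe_tubeCongr]
  exact mirrorIso_eq_self b hy

/-- Switched off, the mirror is the identity re-framing. [folklore] -/
theorem mirrorMap_false (h : HandleAttachingMap 3 2 M) : mirrorMap h false = h := by
  cases h
  rfl

/-- The mirror does not change the range `h̄(T)`. [folklore] -/
theorem range_mirrorMap (h : HandleAttachingMap 3 2 M) (b : Bool) :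
    range (mirrorMap h b).toFun = range h.toFun :=
  range_reframe h _ _

/-- The mirror does not change the attaching sphere `h̄(S)`. [folklore] -/
theorem core_mirrorMap (h : HandleAttachingMap 3 2 M) (b : Bool) : (mirrorMap h b).core = h.core :=
  core_reframe h _ _

/-- **The mirror does not change the attaching circle** (`S¹ × 0` lies in `x₃ = 0`). [folklore] -/
theorem attachingCircle_mirrorMap (h : HandleAttachingMap 3 2 M) (b : Bool) :
    (mirrorMap h b).attachingCircle = h.attachingCircle := by
  funext θ
  show (mirrorMap h b).toFun (coreTubePt θ) = h.toFun (coreTubePt θ)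
  rw [mirrorMap_apply, tubeCongr_mirrorIso_eq_self b]
  rw [coe_coe_coreTubePt]
  rfl

/-- The arc `s ↦ (cos s θ, sin s, 0)` of `∂D⁴` lies in the hyperplane `x₃ = 0`. [folklore] -/
theorem tubeArcPt_apply_three (θ : 𝕊¹) (s : ℝ) :
    (((tubeArcPt θ s : ↥(handleTube 3 2)) : 𝔻⁴) : E4) 3 = 0 := by
  by_cases hs : 0 < Real.cos s
  · have h1 : (((tubeArcPt θ s : ↥(handleTube 3 2)) : 𝔻⁴) : E4) = tubeArc θ s := tubeVec_tubeArcPt hs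
    rw [h1, tubeArc]
    simp
  · rw [tubeArcPt, dif_neg hs, coe_coe_coreTubePt]
    rfl

/-- The mirror does not change the attaching map along the framing arc. [folklore] -/
theorem mirrorMap_comp_tubeArcPt (h : HandleAttachingMap 3 2 M) (b : Bool) (θ : 𝕊¹) :
    (mirrorMap h b).toFun ∘ tubeArcPt θ = h.toFun ∘ tubeArcPt θ := by
  funext s
  simp only [comp_apply, mirrorMap_apply]
  rw [tubeCongr_mirrorIso_eq_self b (tubeArcPt_apply_three θ s)]

/-- **The mirror does not change the handle framing** `dh̄(∂/∂x_μ,₁)` of the attaching circle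
(the framing is the velocity of `h̄` along the arc `(cos s θ, sin s, 0)`, which the mirror fixes).
[folklore] -/
theorem attachingFraming_mirrorMap [IsManifold (𝓡∂ 4) ∞ M] (h : HandleAttachingMap 3 2 M) (b : Bool) :
    (mirrorMap h b).attachingFraming = h.attachingFraming := by
  funext θ
  rw [attachingFraming_eq_mfderiv_comp_tubeArcPt, attachingFraming_eq_mfderiv_comp_tubeArcPt,
    mirrorMap_comp_tubeArcPt]

end Mirror

/-! ## §2 Mirroring a sub-family of a Lefschetz link -/

section Link

variable {M : Type} [TopologicalSpace M] [ChartedSpace (EuclideanHalfSpace 4) M]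

/-- **Mirror the handles selected by `p`** in a family of `2`-handle attaching maps. -/
def mirrorFamily {ι : Type*} (h : ι → HandleAttachingMap 3 2 M) (p : ι → Bool) :
    ι → HandleAttachingMap 3 2 M :=
  fun i => mirrorMap (h i) (p i)

/-- The mirrored family, evaluated (it is a `reframe` family, verbatim). [folklore] -/
theorem mirrorFamily_eq {ι : Type*} (h : ι → HandleAttachingMap 3 2 M) (p : ι → Bool) :
    mirrorFamily h p = fun i => (h i).reframe (mirrorIso (p i)) (isHandleSymmetry_mirrorIso (p i)) :=
  rfl

/-- Unselected handles are untouched. [folklore] -/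
theorem mirrorFamily_of_eq_false {ι : Type*} (h : ι → HandleAttachingMap 3 2 M) {p : ι → Bool} {i : ι}
    (hi : p i = false) : mirrorFamily h p i = h i := by
  show mirrorMap (h i) (p i) = h i
  rw [hi, mirrorMap_false]

/-- The complement of the cores does not change under mirroring. [folklore] -/
theorem coe_coresComplement_mirrorFamily [T2Space M] {ι : Type*} [Finite ι]
    (h : ι → HandleAttachingMap 3 2 M) (p : ι → Bool) :
    (coresComplement (mirrorFamily h p) : Set M) = coresComplement h := by
  ext a
  rw [SetLike.mem_coe, SetLike.mem_coe, mirrorFamily_eq, mem_coresComplement_reframe_iff]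

/-- **Multi-attachments do not see the mirroring** (Kosinski VI §5: re-framing by a symmetry of
the model handle; the tree's `isMultiAttachment_reframe_iff`). [folklore] -/
theorem isMultiAttachment_mirrorFamily_iff [T2Space M] [IsManifold (𝓡∂ 4) ∞ M] {ι : Type*} [Finite ι]
    (h : ι → HandleAttachingMap 3 2 M) (p : ι → Bool)
    {X : Type*} [TopologicalSpace X] [ChartedSpace (EuclideanHalfSpace 4) X] :
    IsMultiAttachment (mirrorFamily h p) (𝓡∂ 4) X ↔ IsMultiAttachment h (𝓡∂ 4) X := by
  rw [mirrorFamily_eq]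
  exact isMultiAttachment_reframe_iff _ _

variable {g : ℕ} {l : List ((Fin g ⊕ Fin g → ℤ) × Bool)}
  {h : Fin l.length → HandleAttachingMap 3 2 (Base g)}

/-- The homology shadow of a loop only depends on the loop (congruence in the loop, absorbing the
continuity proof). [folklore] -/
theorem shadow_congr {K K' : 𝕊¹ → Base g} (hK : Continuous K) (hK' : Continuous K') (e : K = K') :
    shadow g K hK = shadow g K' hK' := by
  subst e
  rfl

/-- **`IsLefschetzLink` does not see the mirroring**: the mirrored family has the same ranges,
the same attaching circles (hence the same pages and shadows) and the same handle framings (hence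
the same page twistings). [folklore] -/
theorem isLefschetzLink_mirrorFamily (hl : IsLefschetzLink g l h) (p : Fin l.length → Bool) :
    IsLefschetzLink g l (mirrorFamily h p) where
  disjoint i j hij := by
    show Disjoint (range (mirrorMap (h i) (p i)).toFun) (range (mirrorMap (h j) (p j)).toFun)
    rw [range_mirrorMap, range_mirrorMap]
    exact hl.disjoint hij
  mem_page i θ := by
    show (mirrorMap (h i) (p i)).attachingCircle θ ∈ _
    rw [attachingCircle_mirrorMap]
    exact hl.mem_page i θ
  shadow_eq i :=
    (shadow_congr _ _ (attachingCircle_mirrorMap (h i) (p i))).trans (hl.shadow_eq i)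
  twisting_eq i := by
    have e : (mirrorFamily h p i).attachingCircle = (h i).attachingCircle :=
      attachingCircle_mirrorMap (h i) (p i)
    have e' : (mirrorFamily h p i).attachingFraming = (h i).attachingFraming :=
      attachingFraming_mirrorMap (h i) (p i)
    rw [e, e']
    exact hl.twisting_eq i

/-- **Lefschetz handlebodies do not see the mirroring**: `X` is a Lefschetz handlebody of word `l`
through `h` iff through the mirrored family. [folklore] -/
theorem isLefschetzLink_and_isMultiAttachment_mirrorFamily (hl : IsLefschetzLink g l h)
    (p : Fin l.length → Bool) {X : Type*} [TopologicalSpace X] [ChartedSpace (EuclideanHalfSpace 4) X] :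
    (IsLefschetzLink g l (mirrorFamily h p) ∧ IsMultiAttachment (mirrorFamily h p) (𝓡∂ 4) X) ↔
      (IsLefschetzLink g l h ∧ IsMultiAttachment h (𝓡∂ 4) X) := by
  rw [isMultiAttachment_mirrorFamily_iff]
  exact ⟨fun H => ⟨hl, H.2⟩, fun H => ⟨isLefschetzLink_mirrorFamily hl p, H.2⟩⟩

end Link

/-! ## §3 The registered sub-goal: the mirror ambiguity of handle-oriented meridians -/

section SubGoal

/-- **Sub-goal `stub_Kas_mirror_link` of stub `stub_modelsOn_counts`** (line `modp-braid-orbits`,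
r9; wave 4, W4-G convention finding).  For every Lefschetz link `h` realising `l` and every set `p`
of handles there is a second Lefschetz link `h'` realising `l` — `h̄'ᵢ = h̄ᵢ ∘ diag(1, 1, 1, −1)` for
the selected `i`, `h̄'ᵢ = h̄ᵢ` otherwise — with the same multi-attachments `X` (so `X(F; l)` is a
Lefschetz handlebody through `h` iff through `h'`), the same seam off the cores
`∂ Base g ∖ ⋃ Kᵢ`, agreeing with `h` on the hyperplane `x₃ = 0` of the tube (which carries the
attaching circle, the handle framing `∂/∂x_μ,₁` and Kas' LONGITUDE loop `(θ, θ₀)/√2`), and differing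
from `h` by the reflection `x₃ ↦ −x₃` on the selected handles (which REVERSES Kas' MERIDIAN loop
`(θ₀, φ)/√2 ↦ (θ₀, φ̄)/√2`).  Consequently the meridian classes `mᵢ = (h̄ᵢ)_*[meridian]` of the Kas
design are determined by `IsLefschetzLink` only up to INDEPENDENT signs, and the design lemmas (F)
`Kas_seamOff_presentation`, (G) `Kas_longitude_formula` must be stated with meridians oriented by
`∂ Base g` (see the docstring of `…KasLoops.lean` for the corrected statements and the sign
computation). [folklore] -/
theorem stub_Kas_mirror_link :
    ∀ (g : ℕ) (l : List ((Fin g ⊕ Fin g → ℤ) × Bool))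
      (h : Fin l.length → Literature.Topology.FourManifolds.HandleAttachingMap 3 2
        (Literature.Topology.FourManifolds.LefschetzBase.Base g))
      (p : Fin l.length → Bool),
      Literature.Topology.FourManifolds.LefschetzBase.IsLefschetzLink g l h →
      ∃ h' : Fin l.length → Literature.Topology.FourManifolds.HandleAttachingMap 3 2
          (Literature.Topology.FourManifolds.LefschetzBase.Base g),
        Literature.Topology.FourManifolds.LefschetzBase.IsLefschetzLink g l h' ∧
        (∀ (X : Type) [TopologicalSpace X] [ChartedSpace (EuclideanHalfSpace 4) X],
          Literature.Topology.FourManifolds.HandleAttachingMap.IsMultiAttachment h' (𝓡∂ 4) X ↔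
            Literature.Topology.FourManifolds.HandleAttachingMap.IsMultiAttachment h (𝓡∂ 4) X) ∧
        ((𝓡∂ 4).boundary (Literature.Topology.FourManifolds.LefschetzBase.Base g) ∩
            (Literature.Topology.FourManifolds.HandleAttachingMap.coresComplement h' :
              Set (Literature.Topology.FourManifolds.LefschetzBase.Base g)) =
          (𝓡∂ 4).boundary (Literature.Topology.FourManifolds.LefschetzBase.Base g) ∩
            (Literature.Topology.FourManifolds.HandleAttachingMap.coresComplement h :
              Set (Literature.Topology.FourManifolds.LefschetzBase.Base g))) ∧
        (∀ i, p i = false → h' i = h i) ∧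
        (∀ (i : Fin l.length) (y : ↥(Literature.Topology.FourManifolds.handleTube 3 2)),
          ((y : Metric.closedBall (0 : EuclideanSpace ℝ (Fin 4)) 1) : EuclideanSpace ℝ (Fin 4)) 3 = 0 →
            (h' i).toFun y = (h i).toFun y) ∧
        (∀ (i : Fin l.length), p i = true → ∀ y y' : ↥(Literature.Topology.FourManifolds.handleTube 3 2),
          (∀ j : Fin 4, ((y' : Metric.closedBall (0 : EuclideanSpace ℝ (Fin 4)) 1) : EuclideanSpace ℝ (Fin 4)) j =
            (if (j : ℕ) = 3 then -1 else 1) *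
              ((y : Metric.closedBall (0 : EuclideanSpace ℝ (Fin 4)) 1) : EuclideanSpace ℝ (Fin 4)) j) →
          (h' i).toFun y' = (h i).toFun y) := by
  intro g l h p hl
  refine ⟨mirrorFamily h p, isLefschetzLink_mirrorFamily hl p, fun X _ _ => isMultiAttachment_mirrorFamily_iff h p,
    ?_, fun i hi => mirrorFamily_of_eq_false h hi, fun i y hy => ?_, fun i hi y y' hy' => ?_⟩
  · rw [coe_coresComplement_mirrorFamily]
  · show (mirrorMap (h i) (p i)).toFun y = (h i).toFun y
    rw [mirrorMap_apply, tubeCongr_mirrorIso_eq_self (p i) hy]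
  · show (mirrorMap (h i) (p i)).toFun y' = (h i).toFun y
    rw [mirrorMap_apply, hi]
    congr 1
    apply Subtype.ext; apply Subtype.ext
    rw [coe_coe_tubeCongr]
    ext j
    rw [mirrorIso_true_apply, hy' j, ← mul_assoc]
    fin_cases j <;> simp [mirrorSign]

end SubGoal

end Summit.SmoothPoincare4.SmoothPoincare4.Theorems.AcyclicBisectionExists.ModpBraidOrbits

end
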